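import Summits.CriticalPhenomena.PercolationContinuityZ3.Theorems.PercNearOneGluingNoHeavyQuantFarLayerOneUnicyclic
import Summits.CriticalPhenomena.PercolationContinuityZ3.Theorems.PercNearOneGluingNoHeavyQuantFarSunRowLeSeven
import HarnessLib

/-!
# QUANT lane R8, front "FAR beyond trees" — layer one of FAR on pendant forests on a cycle with AT MOST SEVEN relays, UNCONDITIONALLY

builds on p205010 (kernel theorem, internal audit signed; external expert review pending)

Support file (`--supports stmt-CriticalPhenomena-4575`, COMPUTATIONAL: it rests on prim-cert-1's `native_decide` sun certificates through
`HairyCycle.sunFAR_of_le_seven`), seat `prim-quant-p1` (gen 18); memo `run/shared/lean/prim/quant/prim-quant-p1-g18/FOR-LEAD-UNICYCLIC-TREES.md` §3.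
No definitions; no sorries.

* `Quant.Bundle.layerOne_of_pforest_of_card_le_seven` — for every `PForest L cyc idx T par dep w` (`…QuantFarLayerOneForest`) and relay set `A ⊆ T ∪ cycle`
  with `|A| ≤ 7`: `2 < Σ_{a∈A} P(c_0 ↔ a)` and `P(c_0 ↮ a) ≤ t` on `A` imply `P(#{a ∈ A : c_0 ↔ a} ≤ 1) ≤ t`
  (`Bundle.farp_one_of_pforest` + `HairyCycle.sunFAR_of_le_seven`).
[cite: KozmaNitzan2024, Conjecture 3 (p. 15)]; [this work].
-/

noncomputable section

namespace Summit.CriticalPhenomena.PercolationContinuityZ3.Theorems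

namespace Quant

namespace Bundle

open Finset MeasureTheory Set
open Literature.Probability.LatticeModels
open Literature.Probability.Percolation
open Summit.CriticalPhenomena.PercolationContinuityZ3.Theorems.HairyCycle (cycE SunFAR)
open scoped Classical

variable {n : ℕ}

section Main

variable {L : ℕ} {cyc : ℕ → Fin n} {idx : Fin n → ℕ}

/-- **UNCONDITIONAL for at most seven relays**: FAR at layer one on every pendant forest on a cycle with `|A| ≤ 7` (observer on the cycle),
by the kernel sun certificates `HairyCycle.sunFAR_of_le_seven`. [this work] -/
theorem layerOne_of_pforest_of_card_le_seven {T : Finset (Fin n)} {par : Fin n → Fin n} {dep : Fin n → ℕ}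
    {w : Sym2 (Fin n) → unitInterval} (P : PForest L cyc idx T par dep w) (A : Finset (Fin n)) (h7 : A.card ≤ 7)
    (hA : ∀ a ∈ A, a ∈ T ∨ ∃ i, i < L ∧ a = cyc i) (t : ℝ)
    (hEN : (2 : ℝ) < ∑ a ∈ A, (prodBernoulli w).real (openConn (cyc 0) a))
    (hcut : ∀ a ∈ A, (prodBernoulli w).real (openConn (cyc 0) a : Set (BondConfig (Fin n)))ᶜ ≤ t) :
    (prodBernoulli w).real {ω : BondConfig (Fin n) | (A.filter fun a => ω ∈ openConn (cyc 0) a).card ≤ 1} ≤ t := by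
  by_cases hoA : cyc 0 ∈ A
  · exact layerOne_of_observer_mem w A hoA t hEN hcut
  have hK : 2 ≤ A.card := by
    have hle : ∑ a ∈ A, (prodBernoulli w).real (openConn (cyc 0) a) ≤ ∑ _a ∈ A, (1 : ℝ) :=
      sum_le_sum fun a _ => measureReal_le_one
    rw [sum_const, nsmul_eq_mul, mul_one] at hle
    have : (2 : ℝ) < A.card := by linarith
    exact_mod_cast this.le
  exact farp_one_of_pforest A (HairyCycle.sunFAR_of_le_seven hK h7 1) _ T par dep w P le_rfl hA hoA (by push_cast; linarith) t hcut

end Main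

end Bundle

end Quant

end Summit.CriticalPhenomena.PercolationContinuityZ3.Theorems
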